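import Summits.BirchSwinnertonDyer.Rank1Residual.O5.HeegnerLogTransportThreeStepZeroEndTwoSided
import HarnessLib
import HarnessLib.Audit.Tags

/-!
# Heegner-log transport at `p = 3` (KL3), part 27: the two-sided END with the twist's `3`-descent
# replaced by the EXACT analytic `3`-unit of the rank-`0` twist (`#Ш(G^{(d_K)})_an ∈ ℤ_{(3)}^×`) — o5-r2 GEN 28

HONEST FRAMING (cell `b2b-bsdres`, run/shared/lean/b2b/bsd-rank1-residual/, verbatim in every file): the
goal of the cell is to DELETE the COMBINATION-SHAPED residual classes of the Birch–Swinnerton-Dyer formula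
for ALL analytic-rank `≤ 1` elliptic curves over `ℚ` — "full BSD formula for every rank `≤ 1` curve in
class `C`" assembled STRICTLY from published theorems — so that the rank-`≤ 1` remainder becomes exactly
the CONSTRUCTION-SHAPED classes, which are TYPED (missing-input `Prop`s), NOT attempted. This is not
"finishing BSD". Team O5 (tame potentially supersingular additive `p = 3`, (t′)), planner o5-r2 (the
non-Iwasawa side), GEN 28; RESEARCH ROUTE; THEOREMS ONLY (bookkeeping over explicit hypotheses): no new
node is WANTED, no Literature fact, no `@[conjecture]`, no new object; NOTHING is booked and no mark of
`RESIDUAL-MAP.md` moves. O5 OPEN.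

## Why this file (memo `HOME/b2b-bsdres-o5-r2/gen28/O5-GEN28.md`, census EVIDENCE `gen28/census/`)

The two-sided END of record (part 25, `o5_index_unit_of_goodOrd_companion_cited_s0d`) discharges
`#Ш(G/K)[3^∞] = 1` by the companion pair's two sharp `3`-descents over `ℚ`: `hSelG` on the rank-`1`
companion `G` (conductor `N_G ≤ 5·10⁴` on the census rows of record — a routine instrument) and `hSelGd`
on the minimal twist `Gd = G^{(d_K)}` (conductor `N_G·d_K² ≈ 10¹⁰` — a `3`-descent there needs the class
groups of cubic fields of that discriminant size: not an instrument anybody runs unconditionally). But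
`Gd` is the RANK-`0` member of the pair, and for a rank-`0` curve the analytic order of `Ш` is an EXACT
rational number, `#Ш(Gd)_an = L(Gd,1)·#Gd(ℚ)_tors² / (Ω_{Gd}·∏c(Gd))` (regulator `1`), computable in exact
arithmetic from the modular symbol of `G` twisted by `χ_{d_K}` (Cremona, Algorithms §2.8, (2.8.9); the
period of the twist by Pal's relation, exact up to a power of `2` since `(d_K, N_G) = 1`). And the END
ALREADY consumes `BSD(Gd,3)` (Yan–Zhu Thm. 4.15 on row C16 via `RowC16.bsdp`, inside the STEP-0
discharge), under which `ord₃ #Ш(Gd)_an = 0 ⟺ Ш(Gd)[3^∞] = 0`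
(`natCard_primaryComponent_sha_eq_one_of_bsdp_of_shaAn_unit`). So THIS file (§2) replaces `hSelGd` by
`hShaAnGd : ∃ q : ℚ, #Ш(Gd)_an = q ∧ ord₃ q = 0` at NO new published input: the per-row data of the END
become a `3`-descent where a descent is cheap (rank `1`, small conductor) and an exact special value where
the special value is exact (rank `0`) — GEN 18's analytic-unit currency `hu₁` for the twist, GEN 27's
descent currency for `G`. §1 is the bookkeeping (`BSD(X,p)` makes `#Ш_an` a well-defined rational whose
`p`-valuation is that of `#Ш[p^∞]`; a sharp `p`-descent with `p ∤ #X(ℚ)_tors` makes the latter `0`);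
§3 is §2 with the unit-log datum a RATIONAL point (part 12), as in part 25 §2. Census (EVIDENCE, memo
§G28-5, kit j193443 + the ids named there): `#Ш(Gd)_an` = `1`, `1`, `4` numerically (error `< 10⁻³⁵`) on
the three rows of record `149895d1 ~ 16655c1` (`d_K = −356`), `240930b1 ~ 26770a1` (`−551`),
`430425o1 ~ 47825d1` (`−344`), and EXACTLY `ord₃ = 0` by the twisted modular-symbol sum at level `16655`
(`S = Σ (d_K/a)·x⁻({∞, a/356}) = 4`; the two larger levels are memory-bound, ids in the memo); `9` resp.
`81` on the eight B-family pairs where the END is silent. Per pair the three `W` are already GEN 3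
`CheckedT` rows (`O5/HeegnerIndexRecordsThreeRankOneT1/T2/T4.lean`: the index of `P_W` itself, two
engines), so this END is the TRANSPORT reading — the (t′) conclusion from companion-side data — not a new
`BSD₃` instance.

## TYPER PLACEMENT NOTE

Place as `O5/HeegnerLogTransportThreeStepZeroEndTwoSidedShaAn.lean` AFTER part 25
(`O5/HeegnerLogTransportThreeStepZeroEndTwoSided.lean`, in the tree), which this file imports; THEOREMS
only, namespace `Summit.BirchSwinnertonDyer.Rank1Residual.O5.HeegnerLogTransport`; no `def`.
CONTENT LABELS: THEOREMS ONLY — 0 `def`, 0 `@[conjecture]`, 0 Literature facts (net named-fact debt 0),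
no `sorry`; published inputs stay displayed hypotheses BY NAME. HONEST FRAMING as above; census = EVIDENCE,
never a Literature fact; O5 OPEN; nothing booked.

### cc-typer-5 GEN 20 (O5 §3.5 / O6 §3.4 typer of record) — by-name ask A-O5-G28-1 (a) of o5-r2 GEN 28, HOME/INBOX.md l.15140 + P.S. 1b l.15154 (sha correction: 95ef7c5aa3f4301d
SUPERSEDES the pre-census draft 2f514210c7d84877; declarations byte-unchanged); memo `HOME/b2b-bsdres-o5-r2/gen28/O5-GEN28.md`.

Source: `HOME/b2b-bsdres-o5-r2/gen28/lean/HeegnerLogTransportThreeStepZeroEndTwoSidedShaAn.lean` sha16 `95ef7c5aa3f4301d` (283 l.; `gen28/SHA16.txt`; o5-r2's farm checks rc 0 / 0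
warnings / 0 sorries, axioms standard, dedup clean),
re-hashed by the typer right before writing; THIS file = the source VERBATIM + this paragraph (imports, module text, every declaration block byte-identical; script
`class-closure/typer-5/gen20/g28_place.py`, docstring anchor asserted); imports part 25 `…StepZeroEndTwoSided` (p361579, this seat) + HarnessLib only — all in the tree; the
typer's own standalone farm check
on tree imports (rc 0 / 0 warnings / 0 sorries; `#print axioms` of the ENDs standard) and DEDUP (`lean search --decl` on the new names: no match) precede the proposal.
CONTENT LABELS (source, unchanged): THEOREMS ONLY (6: §1 glue `padicValRat_eq_zero_of_shaAn_unit`, `padicValRat_shaAn_eq_zero_of_card_selmerGroup`,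
`natCard_primaryComponent_sha_eq_one_of_bsdp_of_shaAn_unit`, `hshaW_of_threeDescent_of_shaAn_unit`; the ENDs `o5_index_unit_of_goodOrd_companion_cited_s0e` (+ `_rat`) = part 25's
`_cited_s0d` with `hSelGd` REPLACED by `hShaAnGd : ∃ q : ℚ, shaAn Gd = (q : ℂ) ∧ padicValRat 3 q = 0` — no new published input); 0 `def`, 0 `@[conjecture]`, 0 Literature facts
(net named-fact debt 0), no `sorry`; published inputs stay displayed hypotheses
BY NAME, nothing re-proved.  HONEST FRAMING (cell `b2b-bsdres`): research route, lane CLASS-CLOSURE §3.5 O5; CONDITIONAL ENDs — nothing asserted beyond the displayed binders,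
nothing booked, no mark / label / count / tier of `RESIDUAL-MAP.md` moves; census / instrument statements (`hIdx`, `hQunit`, `hShaAnGd`, the 3-descents) = EVIDENCE or
displayed binders, never a Literature fact; O5 OPEN.
-/

set_option autoImplicit false

noncomputable section

open scoped Classical

open WeierstrassCurve Literature.NumberTheory.EllipticCurves
  Literature.NumberTheory.EllipticCurves.ModularForms
  Literature.NumberTheory.EllipticCurves.Rank1Residual
  Literature.NumberTheory.EllipticCurves.Rank1Residual.Typed
open Summit.BirchSwinnertonDyer.Rank1Residual.X11b (embAt)
open Summit.BirchSwinnertonDyer.Rank1Residual.Additive.LocalLog (padicLog)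
open IsDedekindDomain (HeightOneSpectrum)
open scoped NumberField

namespace Summit.BirchSwinnertonDyer.Rank1Residual.O5.HeegnerLogTransport

/-! ## §1 Bookkeeping: the analytic `p`-unit currency versus `Ш[p^∞]` under `BSD(X,p)` -/

/-- The rational value of `#Ш(X)_an` is unique, so an analytic `p`-unit certificate transfers to ANY
rational value of it (the form in which the STEP-0 discharge produces `q₁`). [cite: Miller2011LMS, Def. 1.1 (arXiv:1010.2431 p. 3)] -/
theorem padicValRat_eq_zero_of_shaAn_unit (X : WeierstrassCurve ℚ) [X.IsElliptic] (p : ℕ) {q : ℚ}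
    (hq : shaAn X = (q : ℂ)) (hunit : ∃ q' : ℚ, shaAn X = (q' : ℂ) ∧ padicValRat p q' = 0) :
    padicValRat p q = 0 := by
  obtain ⟨q', hq', hv⟩ := hunit
  have hqq : q = q' := by exact_mod_cast hq.symm.trans hq'
  rw [hqq]; exact hv

/-- Under `BSD(X,p)`, a sharp `p`-descent over `ℚ` with `p ∤ #X(ℚ)_tors` (so `Ш(X)[p^∞] = 0`, part 19's
`natCard_primaryComponent_sha_eq_one_of_card_selmerGroup`) makes every rational value of `#Ш(X)_an` a
`p`-adic unit. [cite: Miller2011LMS, Def. 1.1 (arXiv:1010.2431 p. 3)] [cite: SilvermanAEC2009, Thm. X.4.2(a)] -/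
theorem padicValRat_shaAn_eq_zero_of_card_selmerGroup (X : WeierstrassCurve ℚ) [X.IsElliptic] (p : ℕ)
    [Fact p.Prime] (hB : BSDp X p) (htors : ¬ p ∣ X.torsionOrder)
    (hSel : Nat.card (X.selmerGroup (p : ℤ)) = p ^ X.mordellWeilRank) {q : ℚ} (hq : shaAn X = (q : ℂ)) :
    padicValRat p q = 0 := by
  obtain ⟨-, -, q', hq', hv⟩ := hB
  have hqq : q = q' := by exact_mod_cast hq.symm.trans hq'
  rw [hqq, hv, natCard_primaryComponent_sha_eq_one_of_card_selmerGroup X p htors hSel,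
    padicValNat_one_right, Nat.cast_zero]

/-- Conversely, under `BSD(X,p)` an analytic `p`-unit certificate gives `Ш(X)[p^∞] = 0` (a finite
`p`-primary group of `p`-valuation `0` is trivial) — so at the rank-`0` twist of the END the exact special
value and the `3`-descent certify the same thing. [cite: Miller2011LMS, Def. 1.1 (arXiv:1010.2431 p. 3)] -/
theorem natCard_primaryComponent_sha_eq_one_of_bsdp_of_shaAn_unit (X : WeierstrassCurve ℚ) [X.IsElliptic]
    (p : ℕ) [hp : Fact p.Prime] (hB : BSDp X p)
    (hunit : ∃ q : ℚ, shaAn X = (q : ℂ) ∧ padicValRat p q = 0) :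
    Nat.card (AddCommGroup.primaryComponent X.sha p) = 1 := by
  obtain ⟨-, hfin, q', hq', hv⟩ := hB
  haveI : Finite (AddCommGroup.primaryComponent X.sha p) := hfin
  have h0 : padicValNat p (Nat.card (AddCommGroup.primaryComponent X.sha p)) = 0 := by
    have h := padicValRat_eq_zero_of_shaAn_unit X p hq' hunit
    rw [hv] at h
    exact_mod_cast h
  obtain ⟨n, hn⟩ := exists_card_addPrimaryComponent_eq_pow (A := X.sha) p
  rw [hn, padicValNat.prime_pow] at h0
  rw [hn, h0, pow_zero]

/-- **`#Ш(W/K)[3^∞] = 1` from ONE `3`-descent and ONE exact special value**: `W` with `3 ∤ #W(ℚ)_tors` and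
a sharp `3`-descent, its twist `W_t = W^{(d_K)}` with `BSD(W_t,3)` and `ord₃ #Ш(W_t)_an = 0`; then
`Ш(W_K/K)[3^∞] = Ш(W)[3^∞] ⊕ Ш(W_t)[3^∞] = 0` (`3` odd; tree theorem
`card_primaryComponent_sha_baseChange_quadratic_of_odd_of_finite`). [cite: JetchevSkinnerWan2017, §7.4.1 (arXiv:1512.06894 p. 30)]
[cite: Miller2011LMS, Def. 1.1 (arXiv:1010.2431 p. 3)] [cite: SilvermanAEC2009, Thm. X.4.2(a)] -/
theorem hshaW_of_threeDescent_of_shaAn_unit (W : WeierstrassCurve ℚ) [W.IsElliptic] (K : Type) [Field K]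
    [NumberField K] (hK : IsImaginaryQuadratic K) (Wt : WeierstrassCurve ℚ) [Wt.IsElliptic]
    (hWt : ∃ C : VariableChange ℚ, C • W.quadraticTwist (NumberField.discr K : ℚ) = Wt)
    (htors : ¬ 3 ∣ W.torsionOrder) (hSel : Nat.card (W.selmerGroup (3 : ℤ)) = 3 ^ W.mordellWeilRank)
    (hBt : BSDp Wt 3) (hunit : ∃ q : ℚ, shaAn Wt = (q : ℂ) ∧ padicValRat 3 q = 0) :
    Nat.card (AddCommGroup.primaryComponent (W.baseChange K).sha 3) = 1 := by
  haveI : Fact (Nat.Prime 3) := ⟨Nat.prime_three⟩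
  haveI : (W.baseChange K).IsElliptic := by rw [WeierstrassCurve.baseChange]; infer_instance
  have hcW := natCard_primaryComponent_sha_eq_one_of_card_selmerGroup W 3 htors (by exact_mod_cast hSel)
  have hcWt := natCard_primaryComponent_sha_eq_one_of_bsdp_of_shaAn_unit Wt 3 hBt hunit
  haveI : Finite (AddCommGroup.primaryComponent W.sha 3) :=
    Nat.finite_of_card_ne_zero (by rw [hcW]; exact one_ne_zero)
  haveI : Finite (AddCommGroup.primaryComponent Wt.sha 3) :=
    Nat.finite_of_card_ne_zero (by rw [hcWt]; exact one_ne_zero)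
  rw [card_primaryComponent_sha_baseChange_quadratic_of_odd_of_finite W K hK.1 Wt hWt (W.baseChange K)
    ⟨1, one_smul _ _⟩ 3 (by norm_num), hcW, hcWt]

/-! ## §2 The two-sided END with `hSelGd` replaced by the exact analytic `3`-unit of the rank-`0` twist -/

/-- **O5 (t′) TWO-SIDED END, exact-special-value form of the twist binder (o5-r2 GEN 28).** Part 25's
`o5_index_unit_of_goodOrd_companion_cited_s0d` with the `3`-descent on the minimal twist `Gd` (`hSelGd`)
REPLACED by `hShaAnGd : #Ш(Gd)_an ∈ ℚ is a 3-adic unit` — for the rank-`0` member of the companion pair an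
EXACT rational computation (twisted modular symbols). No new published input: `BSD(Gd,3)` (Yan–Zhu on row
C16) is already consumed by the STEP-0 discharge, and under it the two binders certify the same thing (§1).
All other binders and the conclusion `3 ∤ [W(K) : ℤP]` exactly as in part 25; proof = part 25's with
`#Ш(G/K)[3^∞] = 1` supplied by `hshaW_of_threeDescent_of_shaAn_unit`. [cite: KrizLi2019, Thm. 1.16, Rem. 1.17]
[cite: YanZhu2024MainConjNonCM, Thm. 4.15 (§4.6) = Cor. 1.4] [cite: CremonaAlgorithms1997, §2.8 (2.8.9)]
[cite: GrossZagier1986, Thm. I.6.3 with V.§2 (pp. 310–312)] [cite: JetchevSkinnerWan2017, §7.4.1 (arXiv:1512.06894 p. 30)]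
[cite: SilvermanAEC2009, Thm. X.4.2(a)] [cite: Wuthrich2014, Lemma 20 (p. 399)] -/
theorem o5_index_unit_of_goodOrd_companion_cited_s0e
    (hKL : KrizLi2019.thm116_padicLogHeegner_congruence)
    (hYZ : YanZhu2026.thm415_padicValRat_bsd_rank_le_one)
    (hW20 : Wuthrich2014.lemma20_surjective_threeAdic_of_semistable)
    (hmod : exists_isNewformOf) (hGZK : rank_eq_analyticRank_of_analyticRank_le_one)
    (W G : WeierstrassCurve ℚ) [W.IsElliptic] [W.IsGloballyMinimal] [G.IsElliptic] [G.IsGloballyMinimal]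
    (hcong : ∀ ℓ : ℕ, ℓ.Prime → ¬ (ℓ ∣ 3 * W.conductorNorm ℤ * G.conductorNorm ℤ) →
      ((W.LFunction ℓ : ℤ) : ZMod 3) = ((G.LFunction ℓ : ℤ) : ZMod 3))
    (hρ : W.HasSurjectiveModNGaloisRep 3) (hadd : Addv W 3)
    (hunitW : ∀ ℓ ∈ klSet W G, ℓ ≠ 3 → padicValInt 3 (nsCount W ℓ) = 0)
    (hunitG : ∀ ℓ ∈ klSet G W, ℓ ≠ 3 → padicValInt 3 (nsCount G ℓ) = 0)
    (htam : ¬ 3 ∣ W.tamagawaProduct) (htamG : ¬ 3 ∣ G.tamagawaProduct) (hordG : GoodOrd G 3)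
    (Gd : WeierstrassCurve ℚ) [Gd.IsElliptic] [Gd.IsGloballyMinimal] (htamGd : ¬ 3 ∣ Gd.tamagawaProduct)
    {N N' : ℕ} [NeZero N] [NeZero N'] (D : ModularParametrizationData W N)
    (D' : ModularParametrizationData G N')
    (K : Type) [Field K] [NumberField K] (hK : IsImaginaryQuadratic K)
    (hH : SatisfiesHeegnerHypothesis N K) (hH' : SatisfiesHeegnerHypothesis N' K)
    (h3K : SatisfiesHeegnerHypothesis 3 K)
    (hKoG : kolyvagin N' G K) (hGZG : gross_zagier N' G K)
    (hd : NumberField.discr K < -4)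
    (hGd : ∃ C : VariableChange ℚ, C • G.quadraticTwist (NumberField.discr K : ℚ) = Gd)
    (H : HeegnerDatum N (NumberField.discr K)) (H' : HeegnerDatum N' (NumberField.discr K))
    (ι : K →+* ℂ) (ι₃ : K →+* ℚ_[3])
    (P : (W.baseChange K).toAffine.Point) (P' Q : (G.baseChange K).toAffine.Point)
    (hP : WeierstrassCurve.Affine.Point.map ι.toRatAlgHom P = heegnerPointComplex D H)
    (hP' : WeierstrassCurve.Affine.Point.map ι.toRatAlgHom P' = heegnerPointComplex D' H')
    (hPinf : ¬ IsOfFinAddOrder P) (hP'inf : ¬ IsOfFinAddOrder P') (hQ : ¬ IsOfFinAddOrder Q)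
    (hQunit : X11b.padicLogOrd G 3 ι₃ Q + padicValInt 3 (nsCount G 3) - 1 = 0)
    (hSelG : Nat.card (G.selmerGroup (3 : ℤ)) = 3 ^ G.mordellWeilRank)
    (hShaAnGd : ∃ q : ℚ, shaAn Gd = (q : ℂ) ∧ padicValRat 3 q = 0)
    (hcD : padicValInt 3 D.maninConstant = 0) (hc3' : ¬ ((3 : ℤ) ∣ D'.maninConstant)) :
    padicValNat 3 (AddSubgroup.zmultiples P).index = 0 := by
  haveI : Fact (Nat.Prime 3) := ⟨Nat.prime_three⟩
  -- elementary consequences of the binders (as in part 25)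
  have h3d : ¬ ((3 : ℤ) ∣ NumberField.discr K) := not_three_dvd_discr_of_split K hK h3K
  have hμ : ¬ 3 ∣ NumberField.Units.torsionOrder K := not_three_dvd_unitsTorsionOrder_of_discr_lt K hK hd
  have hcD' : padicValInt 3 D'.maninConstant = 0 := padicValInt.eq_zero_of_not_dvd hc3'
  obtain ⟨Cd, hCd⟩ := hGd
  have hu : padicValRat 3 (Cd.u : ℚ) = 0 :=
    AdditivePotMult.padicValRat_u_eq_zero_of_twist_minimal_of_split G 3 K hK h3K Cd hCd
  have hE : hasEntireLFunction_rat := hasEntireLFunction_rat_of_exists_isNewformOf hmod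
  have hWa3 : W.LFunction 3 = 0 :=
    W.LFunction_apply_eq_zero_of_not_good_of_not_mult 3 hadd.1 hadd.2 (dvd_refl 3)
  have hNW : W.conductorNorm ℤ ≠ 0 := (W.conductorNorm_pos_holds).ne'
  have hNG : G.conductorNorm ℤ ≠ 0 := (G.conductorNorm_pos_holds).ne'
  have hN' : N' = G.conductorNorm ℤ :=
    IsNewformOf.level_eq_conductorNorm_of_exists_isNewformOf hmod D'.isNewformOf
  have hHG : SatisfiesHeegnerHypothesis (G.conductorNorm ℤ) K := hN' ▸ hH'
  -- class-level discharges: row C16 for the companion pair, analytic ranks ≤ 1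
  have hC16 : RowC16 G 3 := rowC16_three_of_goodOrd_of_isCongruentModThree W G hcong hρ hordG
  have hC16d : RowC16 Gd 3 := rowC16_three_twist_of_heegner G Gd K hK hHG h3d ⟨Cd, hCd⟩ hC16
  obtain ⟨hrG, hrGd⟩ := analyticRank_pair_le_one_of_heegner_nonTorsion hmod G D' K hK hH' hGZG Gd ⟨Cd, hCd⟩
    ⟨D', H', ι, hP'⟩ hP'inf
  haveI : Finite G.sha := (hGZK G hrG).2
  haveI : Finite Gd.sha := (hGZK Gd hrGd).2
  -- STEP-0 (GEN 22): `BSD(G,3)`, `BSD(Gd,3)` by Yan–Zhu on row C16; the two analytic orders are rational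
  have hBGd : BSDp Gd 3 := RowC16.bsdp hYZ hW20 hE hGZK hrGd hC16d
  obtain ⟨q₀, hq₀, -⟩ := missingPPartAt_of_bsdp G 3 (RowC16.bsdp hYZ hW20 hE hGZK hrG hC16)
  obtain ⟨q₁, hq₁, -⟩ := missingPPartAt_of_bsdp Gd 3 hBGd
  have hstep0 := stepZero_three_of_heegner_pair G N' K D' H' ι P' hGZG hKoG hGZK hE hK hH' hP' hP'inf
    hc3' hμ hrG Gd Cd hCd hu hrGd htamG htamGd hq₀ hq₁
  -- `#Ш(G/K)[3^∞] = 1` from ONE 3-descent (`G`, torsion by row C16) and the exact analytic unit of `Gd` (§1)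
  have hsha : Nat.card (AddCommGroup.primaryComponent (G.baseChange K).sha 3) = 1 :=
    hshaW_of_threeDescent_of_shaAn_unit G K hK Gd ⟨Cd, hCd⟩
      (Supersingular.not_dvd_torsionOrder_of_irr G 3 hC16.2.2.1) hSelG hBGd hShaAnGd
  -- the Heegner point of the companion has finite index (Kolyvagin)
  have hI0 : (AddSubgroup.zmultiples P').index ≠ 0 :=
    index_zmultiples_ne_zero_of_kolyvagin G K hKoG hK hH' ⟨D', H', ι, hP'⟩ hP'inf
  -- companion side (GEN 18): the Kriz–Li-normalised Heegner log of `G` is a `3`-adic unit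
  have hGunit : X11b.padicLogOrd G 3 ι₃ P' + padicValInt 3 (nsCount G 3) - 1 = 0 :=
    goodOrd_companion_logUnit_three_of_sha hYZ hW20 hE hGZK G hrG hC16 Gd hrGd hC16d K hK ⟨Cd, hCd⟩ ι₃
      P' Q hP'inf hQ hI0 hQunit D' hq₀ hq₁ hstep0 hsha htamG hcD'
  -- W side (GEN 16) with KL3-A := Kriz–Li Thm. 1.16 by name (part 14)
  exact padicValNat_index_eq_zero_of_companion_unit'
    (krizLiUnitBitTransportThree_of_thm116_of_exists_isNewformOf hKL hmod) W G hcong hρ hadd hWa3 hNW hNG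
    hunitW hunitG htam D D' K hK hH hH' hd h3d H H' ι ι₃ P P' hP hP' hPinf hP'inf hcD hcD' hGunit

/-! ## §3 The same END with the unit-log datum a RATIONAL point of the companion (part 12) -/

/-- **§2, certificate form of the unit-log binder** (as part 25 §2): `Q`, `hQ`, `hQunit` replaced by a
rational point `Q₀ ∈ G(ℚ)` of infinite order whose `ℤ₃`-linearly extended formal-group logarithm at
`Q₀ ⊗ ℚ₃` has valuation `1 − v₃ |G̃(𝔽₃)|` (part 12's `padicLogOrd_map_ofId_eq_valuation_padicLog`).
Per-row data of this END: `hcong`, `hρ`, `hadd`, `hunitW`, `hunitG`, `htam`, `htamG`, `htamGd`, `hordG`,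
Manin units, ONE `3`-descent (`hSelG`, rank-`1` member), ONE exact special value (`hShaAnGd`, rank-`0`
member), the rational unit-log point; published theorems BY NAME; Heegner data. [cite: KrizLi2019, Thm. 1.16, Rem. 1.17]
[cite: Castella2018, §2.2 and Thm. 2.3 (arXiv:1704.06608 p. 5)] [cite: YanZhu2024MainConjNonCM, Thm. 4.15 (§4.6) = Cor. 1.4]
[cite: CremonaAlgorithms1997, §2.8 (2.8.9)] -/
theorem o5_index_unit_of_goodOrd_companion_cited_s0e_rat
    (hKL : KrizLi2019.thm116_padicLogHeegner_congruence)
    (hYZ : YanZhu2026.thm415_padicValRat_bsd_rank_le_one)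
    (hW20 : Wuthrich2014.lemma20_surjective_threeAdic_of_semistable)
    (hmod : exists_isNewformOf) (hGZK : rank_eq_analyticRank_of_analyticRank_le_one)
    (W G : WeierstrassCurve ℚ) [W.IsElliptic] [W.IsGloballyMinimal] [G.IsElliptic] [G.IsGloballyMinimal]
    (hcong : ∀ ℓ : ℕ, ℓ.Prime → ¬ (ℓ ∣ 3 * W.conductorNorm ℤ * G.conductorNorm ℤ) →
      ((W.LFunction ℓ : ℤ) : ZMod 3) = ((G.LFunction ℓ : ℤ) : ZMod 3))
    (hρ : W.HasSurjectiveModNGaloisRep 3) (hadd : Addv W 3)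
    (hunitW : ∀ ℓ ∈ klSet W G, ℓ ≠ 3 → padicValInt 3 (nsCount W ℓ) = 0)
    (hunitG : ∀ ℓ ∈ klSet G W, ℓ ≠ 3 → padicValInt 3 (nsCount G ℓ) = 0)
    (htam : ¬ 3 ∣ W.tamagawaProduct) (htamG : ¬ 3 ∣ G.tamagawaProduct) (hordG : GoodOrd G 3)
    (Gd : WeierstrassCurve ℚ) [Gd.IsElliptic] [Gd.IsGloballyMinimal] (htamGd : ¬ 3 ∣ Gd.tamagawaProduct)
    {N N' : ℕ} [NeZero N] [NeZero N'] (D : ModularParametrizationData W N)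
    (D' : ModularParametrizationData G N')
    (K : Type) [Field K] [NumberField K] (hK : IsImaginaryQuadratic K)
    (hH : SatisfiesHeegnerHypothesis N K) (hH' : SatisfiesHeegnerHypothesis N' K)
    (h3K : SatisfiesHeegnerHypothesis 3 K)
    (hKoG : kolyvagin N' G K) (hGZG : gross_zagier N' G K)
    (hd : NumberField.discr K < -4)
    (hGd : ∃ C : VariableChange ℚ, C • G.quadraticTwist (NumberField.discr K : ℚ) = Gd)
    (H : HeegnerDatum N (NumberField.discr K)) (H' : HeegnerDatum N' (NumberField.discr K))
    (ι : K →+* ℂ) (ι₃ : K →+* ℚ_[3])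
    (P : (W.baseChange K).toAffine.Point) (P' : (G.baseChange K).toAffine.Point)
    (hP : WeierstrassCurve.Affine.Point.map ι.toRatAlgHom P = heegnerPointComplex D H)
    (hP' : WeierstrassCurve.Affine.Point.map ι.toRatAlgHom P' = heegnerPointComplex D' H')
    (hPinf : ¬ IsOfFinAddOrder P) (hP'inf : ¬ IsOfFinAddOrder P')
    (Q₀ : G.toAffine.Point) (hQ₀ : ¬ IsOfFinAddOrder Q₀)
    (hQ₀unit : (padicLog (G.baseChange ℚ_[3])
        (Affine.Point.map (W' := G.toAffine) (S := ℚ) (Algebra.ofId ℚ ℚ_[3]) Q₀)).valuation +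
      padicValInt 3 (nsCount G 3) - 1 = 0)
    (hSelG : Nat.card (G.selmerGroup (3 : ℤ)) = 3 ^ G.mordellWeilRank)
    (hShaAnGd : ∃ q : ℚ, shaAn Gd = (q : ℂ) ∧ padicValRat 3 q = 0)
    (hcD : padicValInt 3 D.maninConstant = 0) (hc3' : ¬ ((3 : ℤ) ∣ D'.maninConstant)) :
    padicValNat 3 (AddSubgroup.zmultiples P).index = 0 := by
  haveI : Fact (Nat.Prime 3) := ⟨Nat.prime_three⟩
  have hQ : ¬ IsOfFinAddOrder (Affine.Point.map (W' := G.toAffine) (S := ℚ) (Algebra.ofId ℚ K) Q₀) :=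
    not_isOfFinAddOrder_map_ofId G Q₀ hQ₀
  have hQunit : X11b.padicLogOrd G 3 ι₃ (Affine.Point.map (W' := G.toAffine) (S := ℚ) (Algebra.ofId ℚ K) Q₀) +
      padicValInt 3 (nsCount G 3) - 1 = 0 := by
    rw [padicLogOrd_map_ofId_eq_valuation_padicLog G 3 ι₃ Q₀ hQ₀]; exact hQ₀unit
  exact o5_index_unit_of_goodOrd_companion_cited_s0e hKL hYZ hW20 hmod hGZK W G hcong hρ hadd hunitW hunitG
    htam htamG hordG Gd htamGd D D' K hK hH hH' h3K hKoG hGZG hd hGd H H' ι ι₃ P P' _ hP hP' hPinf hP'inf hQ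
    hQunit hSelG hShaAnGd hcD hc3'

end Summit.BirchSwinnertonDyer.Rank1Residual.O5.HeegnerLogTransport

end
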